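import Mathlib
import Literature.MathematicalPhysics.QuantumFieldTheory.Balaban1983to89.B13Sect1Arith
import Literature.MathematicalPhysics.QuantumFieldTheory.Balaban1983to89.B13Factor210

/-!
# [Balaban1988RG2Cluster] (1.9) = (1.10) p. 4: the decoupling expansion RESUMMED OVER CONNECTED DOMAINS — the
# vanishing of the disconnected `σ`-terms («the derivatives with respect to s restricted to these components render
# the term equal to 0») KERNEL-CHECKED in the Cauchy representation (1.23) that the tree's `B13Sect1Arith.cauchyOp`
# models (cell topic `Summits/QuantumFields/BalabanUV/Beta`; row-D4 terminal leaf (T4)(b), caveat C1)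

HONEST FRAMING (cell rule).  Discharging `BetaPertH` makes Bałaban's UV stability UNCONDITIONAL — a real
constructive-QFT result; NOT the continuum limit, NOT the Clay problem.  This module discharges NOTHING of `BetaPertH`.
It is the row-D4 owner's kernel form of ONE PROSE STEP of print — the passage from the multivariate decoupling
expansion (1.9) to the sum over CONNECTED domains (1.10) of [II] p. 4 (class «P, argued in print» in the b13∕r2 census
`CENSUS-B13-v2.md` row p. 4; the SUPPORT half of the row-D4 census caveat C1 «the assembled (1.10)-support bookkeeping
of the non-local terms T3∕T5∕T6», `BETA/REMAINDER-BETA.md` §10.9.1) — proved ON THE TREE'S OWN OBJECT: the iterated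
one-variable operation `cauchyOp` of `B13Sect1Arith` (pv20-g2), by which the cell models the terms of (1.10)∕(1.38) in
the representation (1.23).  [folklore] one-variable complex analysis + finite-sum bookkeeping + the wall-component
geometry of `B14Components`∕`B13Factor210` (b14∕b13 lineages), all BY NAME; NOT summit progress.  Unit
`b2b-balaban-beta-an4-g34` (owner of `BINDER-OWNERS.md` row D4); cell `GAPS.md` C-an4-65.

CITATION HEADER (lean-in-tree rule).  [II] = T. Bałaban, *Renormalization group approach to lattice gauge field
theories. II. Cluster expansions*, Commun. Math. Phys. **116**, 1–22 (1988) [Balaban1988RG2Cluster] (journal page =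
PDF page; renders `HOME/b2b-balaban-ref1/pages/1988-cmp116-rg-II-cluster/…-p003-x2.png`, `…-p004-x2.png`,
`…-p007-x2.png`, `…-p010-x2.png`, `…-p011-x2.png`, READ AS IMAGES by this unit); [I] = T. Bałaban, *… I. Generation of
effective actions in a small field approximation and a coupling constant renormalization in four dimensions*, Commun.
Math. Phys. **109**, 249–301 (1987) [Balaban1987RG1] (render `…1987-cmp109-rg-I-small-field-p020-x2.png`, p. 268, read
as an image: the terms T3, T5, T6 of (2.12), see the sibling module `DecouplingSupport110`).
WHAT IS REPRODUCED — [II] p. 4 [PDF 4], verbatim: display (1.9)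
`E(□₀,(tζ̃_□ + t_□ζ_□)𝐇_k(B′)) = Σ_{σ⊂σ₀} ∏_{Δ∈σ} ∫₀¹ ds(Δ) ∂∕∂s(Δ) E(□₀,(tζ̃_□ + t_□ζ_□)𝐇_k(H(s), G̃(s), H₀(s)B′))|_{s(σᶜ)=0}`,
then *"Consider a term in the last sum. The set Y(σ) = □̃⁴ ∪ (∪_{Δ∈σ}Δ) is a sum of connected components, with the
following notion of connectedness. … We denote by Y₀ the connected component of the domain Y(σ) containing the cube
□̃⁴."* … *"As a consequence of these properties we obtain that the term in the sum on the right-hand side of (1.9),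
corresponding to the set σ, depends on propagators and function B, s restricted to the component Y₀, the component of
Y(σ) containing □̃⁴. If there are other components, then the derivatives with respect to s restricted to these
components render the term equal to 0. This simplifies the sum in (1.9). We can write it as a sum over connected domains
Y₀ containing □̃⁴, with parameters s = 0 on Y₀ᶜ. We denote s by s(Y₀), hence we have"* display (1.10)
`… = Σ_{Y₀} ∏_{Δ⊂Y₀∖□̃⁴} ∫₀¹ ds(Δ) ∂∕∂s(Δ) E(□₀,(tζ̃_□ + t_□ζ_□)𝐇_k(H(s(Y₀)), G̃(s(Y₀)), (H₀B′)(s(Y₀))))`.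
The representation in which the tree holds these terms — [II] (1.23) p. 7, verbatim: *"Let us come back to the
expansion (1.10). We differentiate it with respect to t_□, at t_□ = 0, and we represent all derivatives by the Cauchy
formula. The term in (1.10) corresponding to a domain Y₀ is represented as (1∕2πi)∫ dt_□∕t_□²
∏_{Δ⊂Y₀∖□̃⁴} ∫ds(Δ) (1∕2πi)∫ dσ(Δ)∕(σ(Δ) − s(Δ))² · E(□₀,(tζ̃_□ + t_□ζ_□)𝐇_k(σ(Y₀), B′)), (1.23) where the
t_□-integration is over the circle (1.22), and the σ(Δ)-integrations are over the circles |σ(Δ)| = e^{κ₁}."* — typed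
in the tree as `B13Sect1Arith.cauchyOp ρ l h s σ` (the ordered product over the LIST `l` of cubes of the operations
`∫₀¹ du (2πi)⁻¹∮_{|z|=ρ} dz∕(z − u)² •`, each substituting `u, z` for the listed coordinates of the real∕complex
parameter vectors `s, σ`); the same representation is (1.38) p. 10 for the terms of `𝐏^{(k)}` (root = one cube `□`:
*"For a fixed cube □ we take σ₀ as the family of all cubes Δ disjoint with the interior of □. … the sum in the
decomposition is over all localization domains Y ⊂ 𝐃_k containing the cube □"*).  Connectedness: [I] p. 257 ∕ [II]
p. 4 (chains of cubes, consecutive ones sharing a (d − 1)-dimensional wall) = tree `B14Components.WConn`,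
`B13Factor210.WallConnected` (cubes ↦ their indices `Pt d = Fin d → ℤ`), imported, not duplicated.

WHAT IS CERTIFIED HERE (kernel, sorry-free; [folklore] unless marked).
§1 IDLE-VARIABLE VANISHING on the tree's object: if the integrand `h(s, σ)` does not depend on the listed complex
   variable `σ(i)` on a parameter set closed under the operation's coordinate moves (`IdleOn`, `MovesClosed` — the same
   invariant-set device as `B13Sect1Arith.norm_cauchyOp_le`), then every iterated operation of it is again idle in
   `σ(i)` (`idleOn_cauchyOp`) and the iterated operation over any list CONTAINING `i` is ZERO
   (`cauchyOp_eq_zero_of_idleOn`): the `σ(i)`-circle carries `∮_{|z|=ρ} dz∕(z − u)² • const = 0`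
   (`circleIntegral_inv_sq_smul_const`, Mathlib's `circleIntegral.integral_sub_zpow_of_ne`).  This is the printed
   «the derivatives with respect to s … render the term equal to 0» in the representation (1.23).
§2 THE ROOT COMPONENT AND CONNECTEDNESS: `rootComp R σ a₀` = the cubes of `Y(σ) = R ∪ σ` wall-connected to the root
   cube `a₀ ∈ R` inside `R ∪ σ` (= «Y₀»; `R` = the indices of the cubes of `□̃⁴`, resp. `{□}` for (1.38));
   `wallConnected_union_iff`: for wall-connected `R ∋ a₀`, `Y(σ)` is connected ⇔ `σ ⊆ Y₀(σ)`;
   `exists_not_mem_rootComp` («If there are other components …»); `subset_rootComp_of_wallConnected` (a wall-connected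
   family of cubes of `Y(σ)` meeting `Y₀(σ)` lies in `Y₀(σ)` — consumed by the sibling's walk model);
   `sum_powerset_eq_sum_connected` (vanishing off connected `σ` ⇒ `Σ_{σ⊆σ₀} = Σ_{σ⊆σ₀, Y(σ) connected}`).
§3 THE END: `term19 ρ F σ := cauchyOp ρ σ.toList (fun _ τ ↦ F τ) 0 0` (the `σ`-term: listed parameters moved, all
   others `0` — «s(σᶜ) = 0»); under the SUPPORT HYPOTHESIS `SupportedOnRootComp F R σ₀ a₀` (for `σ ⊆ σ₀` and a cube
   `Δ′ ∈ σ` outside `Y₀(σ)`, `F` at parameters vanishing off `σ` does not read the parameter of `Δ′` — the p. 4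
   sentence «depends on propagators and function B, s restricted to the component Y₀», DERIVED for the term shapes
   T3∕T5∕T6 with walk-decorated propagators in the sibling module `DecouplingSupport110`):
   `term19_eq_zero_of_not_wallConnected` and **`sum_term19_eq_sum_connected`**:
   `Σ_{σ ∈ 𝒫(σ₀)} term19 ρ F σ = Σ_{σ ∈ 𝒫(σ₀), R ∪ σ wall-connected} term19 ρ F σ` — (1.9) = (1.10).
   `term19_empty`: the `Y₀ = □̃⁴` term is `F 0`.

NOT CLAIMED (located, by name).  (a) That (1.9) itself — the multivariate fundamental theorem of calculus — holds for
Bałaban's `E(□₀, …)`, and that the `s`-derivatives EQUAL the Cauchy representation (1.23): exactly as in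
`B13Sect1Arith` (*"Cauchy's integral formula itself (that (1.23) EQUALS the s-derivatives of (1.10)) — [folklore], not
typed"*), the iterated operation is the MODEL of the terms; this file proves the resummation (1.9) = (1.10) for that
model.  (b) The support hypothesis for Bałaban's own integrand `E(□₀,(tζ̃_□ + t_□ζ_□)𝐇_k(H(s), G̃(s), H₀(s)B′))` (the
separation of (1.3)∕(1.4) over the components, p. 4) — the sibling module derives it for the three non-local term
shapes of `𝐏^{(k)}` from the walk structure of the decorated propagators; the `𝐇_k`-term of Lemma 1 needs in addition
the fixed-point locality of `D(H(s), ·)`, `𝐀₀(H(s), G̃(s), ·)` (tree `B13PkLocalTerms`∕`B13CorridorSeparation` give the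
device; not composed here).  (c) Any BOUND ((1.24), (1.39): `B13Sect1Arith.norm_cauchyOp_le'`,
`PkDecoupledTerms`), any constant, the dictionary to Bałaban's objects; NOT summit progress.
MODEL CONVENTIONS (recorded as such): cubes of `σ₀` and of `□̃⁴` ↦ indices `Pt d` at ONE scale (the M-cubes; `□̃⁴`'s
cubes = a finite wall-connected family `R`, e.g. a box — `B14BoxFixWall.ibox_wconn`); parameters indexed by ALL of
`Pt d`, the coordinates outside `σ` frozen at `0` (those of `R` are never read by the sibling's weights); the printed
`∏_{Δ∈σ}` is an ordered iteration over `σ.toList` (as in `B13Sect1Arith`); `E` complete (for a non-complete `E`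
Mathlib's Bochner integral is `0` and everything is trivially `0`).
-/

namespace Summit.QuantumFields.BalabanUV.Beta.DecouplingResummation110

open Literature.MathematicalPhysics.QuantumFieldTheory.Balaban1983to89
open Literature.MathematicalPhysics.QuantumFieldTheory.Balaban1983to89.B13Sect1Arith (cauchyOp)

noncomputable section

section Idle

variable {ι : Type*} [DecidableEq ι] {E : Type*}

/-- `h` is IDLE in the complex decoupling variable `σ(i)` on the parameter set `Q`: changing `σ(i)` does not change
the value. [folklore] -/
def IdleOn (Q : (ι → ℝ) → (ι → ℂ) → Prop) (i : ι) (h : (ι → ℝ) → (ι → ℂ) → E) : Prop :=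
  ∀ s σ, Q s σ → ∀ z : ℂ, h s (Function.update σ i z) = h s σ

/-- A parameter set closed under the moves of the iterated Cauchy operation over the list `l`. [folklore] -/
def MovesClosed (Q : (ι → ℝ) → (ι → ℂ) → Prop) (l : List ι) : Prop :=
  ∀ s σ, Q s σ → ∀ i ∈ l, ∀ u : ℝ, ∀ z : ℂ, Q (Function.update s i u) (Function.update σ i z)

/-- A set closed under the moves of `i :: l` is closed under the moves of `l`. [folklore] -/
theorem MovesClosed.tail {Q : (ι → ℝ) → (ι → ℂ) → Prop} {i : ι} {l : List ι} (hQ : MovesClosed Q (i :: l)) :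
    MovesClosed Q l :=
  fun s σ hs j hj u z => hQ s σ hs j (List.mem_cons_of_mem i hj) u z

variable [NormedAddCommGroup E] [NormedSpace ℂ E]

/-- The one-variable Cauchy kernel of (1.23) integrates to zero against a constant:
`∮_{|z|=ρ} dz∕(z − u)² • c = 0`. [folklore] -/
theorem circleIntegral_inv_sq_smul_const [CompleteSpace E] (ρ : ℝ) (u : ℂ) (c : E) :
    (∮ z in C(0, ρ), ((z - u) ^ 2)⁻¹ • c) = 0 := by
  rw [circleIntegral.integral_smul_const]
  have : (∮ z in C(0, ρ), ((z - u) ^ 2)⁻¹) = 0 := by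
    have h := circleIntegral.integral_sub_zpow_of_ne (n := -2) (by norm_num) (0 : ℂ) u ρ
    simpa [zpow_neg, zpow_ofNat] using h
  rw [this, zero_smul]

/-- If the integrand is idle in `σ(i)` on a moves-closed set, so is every iterated Cauchy operation of it.
[folklore] -/
theorem idleOn_cauchyOp {Q : (ι → ℝ) → (ι → ℂ) → Prop} {i : ι} (ρ : ℝ) :
    ∀ (l : List ι), MovesClosed Q l → ∀ {h : (ι → ℝ) → (ι → ℂ) → E}, IdleOn Q i h →
      IdleOn Q i (cauchyOp ρ l h)
  | [], _, h, hh => by simpa [cauchyOp] using hh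
  | j :: l, hQ, h, hh => by
    intro s σ hs z
    have IH := idleOn_cauchyOp ρ l hQ.tail hh
    simp only [cauchyOp]
    by_cases hji : j = i
    · subst hji
      simp only [Function.update_idem]
    · congr 1
      funext u
      congr 1
      simp only [circleIntegral]
      congr 1
      funext θ
      rw [Function.update_comm (Ne.symm hji)]
      congr 2
      exact IH _ _ (hQ s σ hs j List.mem_cons_self u _) z

/-- **IDLE-VARIABLE VANISHING** of the iterated Cauchy operation of (1.23): if the integrand does not depend on the
listed variable `σ(i)` (on a moves-closed parameter set), the whole iterated integral is `0` — the circle integral in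
`σ(i)` is `∮ dz∕(z − u)² • const = 0`.  This is the kernel form, in the representation (1.23) of the terms of (1.10),
of [II] p. 4: *"the derivatives with respect to s restricted to these components render the term equal to 0"*.
[cite: Balaban1988RG2Cluster, p.4 before (1.10)] -/
theorem cauchyOp_eq_zero_of_idleOn [CompleteSpace E] {Q : (ι → ℝ) → (ι → ℂ) → Prop} {i : ι} (ρ : ℝ) :
    ∀ (l : List ι), MovesClosed Q l → i ∈ l → ∀ {h : (ι → ℝ) → (ι → ℂ) → E}, IdleOn Q i h →
      ∀ s σ, Q s σ → cauchyOp ρ l h s σ = 0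
  | [], _, hi, _, _ => by simp at hi
  | j :: l, hQ, hi, h, hh => by
    intro s σ hs
    simp only [cauchyOp]
    by_cases hji : j = i
    · subst hji
      have hidle := idleOn_cauchyOp ρ l hQ.tail hh
      have hconst : ∀ (u : ℝ) (w : ℂ), cauchyOp ρ l h (Function.update s j u) (Function.update σ j w)
          = cauchyOp ρ l h (Function.update s j u) (Function.update σ j 0) := by
        intro u w
        have := hidle _ _ (hQ s σ hs j List.mem_cons_self u 0) w
        simpa only [Function.update_idem] using this
      simp only [hconst, circleIntegral_inv_sq_smul_const, smul_zero, intervalIntegral.integral_zero]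
    · have hil : i ∈ l := by simpa [Ne.symm hji] using hi
      have IH := cauchyOp_eq_zero_of_idleOn ρ l hQ.tail hil hh
      have hzero : ∀ (u : ℝ) (w : ℂ), cauchyOp ρ l h (Function.update s j u) (Function.update σ j w) = 0 :=
        fun u w => IH _ _ (hQ s σ hs j List.mem_cons_self u w)
      simp only [hzero, smul_zero]
      simp [circleIntegral]

end Idle

/-! ## §2 The root component `Y₀(σ)` and the resummation (1.9) = (1.10) -/

section Geometry

open Literature.MathematicalPhysics.QuantumFieldTheory.Balaban1983to89.B14DomainGeom (Pt)
open Literature.MathematicalPhysics.QuantumFieldTheory.Balaban1983to89.B14Components (WConn)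
open Literature.MathematicalPhysics.QuantumFieldTheory.Balaban1983to89.B14BoxFixWall (WConn.mono)
open Literature.MathematicalPhysics.QuantumFieldTheory.Balaban1983to89.B13Factor210 (WallConnected)

variable {d : ℕ}

open Classical in
/-- The ROOT COMPONENT `Y₀(σ)` of the domain `Y(σ) = R ∪ σ` ([II] p. 4: *"We denote by Y₀ the connected component
of the domain Y(σ) containing the cube □̃⁴"*): the cubes of `R ∪ σ` joined to the root cube `a₀ ∈ R` by a chain of
successively wall-adjacent cubes of `R ∪ σ` (the connectedness of [I] p. 257 ∕ [II] p. 4, tree `B14Components.WConn`).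
Cubes are modelled by their lattice indices `Pt d = Fin d → ℤ`; `R` = the indices of the M-cubes of `□̃⁴`.
[cite: Balaban1988RG2Cluster, p.4 before (1.10)] -/
def rootComp (R σ : Finset (Pt d)) (a₀ : Pt d) : Finset (Pt d) :=
  (R ∪ σ).filter fun b => WConn (↑(R ∪ σ) : Set (Pt d)) a₀ b

/-- Membership in the root component, unfolded. [folklore] -/
theorem mem_rootComp {R σ : Finset (Pt d)} {a₀ b : Pt d} :
    b ∈ rootComp R σ a₀ ↔ b ∈ R ∪ σ ∧ WConn (↑(R ∪ σ) : Set (Pt d)) a₀ b := by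
  classical
  simp [rootComp]

/-- `Y₀(σ) ⊆ Y(σ)`. [folklore] -/
theorem rootComp_subset (R σ : Finset (Pt d)) (a₀ : Pt d) : rootComp R σ a₀ ⊆ R ∪ σ :=
  fun _ hb => (mem_rootComp.1 hb).1

/-- The root family lies in the root component (it is wall-connected and contains the root cube). [folklore] -/
theorem subset_rootComp {R : Finset (Pt d)} {a₀ : Pt d} (hR : WallConnected (↑R : Set (Pt d))) (ha₀ : a₀ ∈ R)
    (σ : Finset (Pt d)) : R ⊆ rootComp R σ a₀ := by
  intro b hb
  refine mem_rootComp.2 ⟨Finset.mem_union_left _ hb, ?_⟩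
  exact WConn.mono (by simp) (hR a₀ (by simpa using ha₀) b (by simpa using hb))

/-- `Y(σ) = R ∪ σ` is connected (in the sense of [II] p. 4) iff every cube of `σ` lies in the root component `Y₀(σ)`.
[folklore] -/
theorem wallConnected_union_iff {R : Finset (Pt d)} {a₀ : Pt d} (hR : WallConnected (↑R : Set (Pt d)))
    (ha₀ : a₀ ∈ R) (σ : Finset (Pt d)) :
    WallConnected (↑(R ∪ σ) : Set (Pt d)) ↔ σ ⊆ rootComp R σ a₀ := by
  constructor
  · intro h b hb
    exact mem_rootComp.2 ⟨Finset.mem_union_right _ hb, h a₀ (by simp [ha₀]) b (by simp [hb])⟩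
  · intro h x hx y hy
    have hx' : WConn (↑(R ∪ σ) : Set (Pt d)) a₀ x := by
      rcases Finset.mem_union.1 (by simpa using hx) with hxR | hxσ
      · exact (mem_rootComp.1 (subset_rootComp hR ha₀ σ hxR)).2
      · exact (mem_rootComp.1 (h hxσ)).2
    have hy' : WConn (↑(R ∪ σ) : Set (Pt d)) a₀ y := by
      rcases Finset.mem_union.1 (by simpa using hy) with hyR | hyσ
      · exact (mem_rootComp.1 (subset_rootComp hR ha₀ σ hyR)).2
      · exact (mem_rootComp.1 (h hyσ)).2
    exact hx'.symm.trans hy'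

/-- The root component ABSORBS wall-connected families: a wall-connected family of cubes of `Y(σ)` meeting `Y₀(σ)`
lies inside `Y₀(σ)` (a chain inside `R ∪ σ` from the root reaches every cube of the family). [folklore] -/
theorem subset_rootComp_of_wallConnected {R σ S : Finset (Pt d)} {a₀ a : Pt d}
    (hS : WallConnected (↑S : Set (Pt d))) (hSY : S ⊆ R ∪ σ) (haS : a ∈ S) (ha : a ∈ rootComp R σ a₀) :
    S ⊆ rootComp R σ a₀ := by
  intro b hb
  refine mem_rootComp.2 ⟨hSY hb, ?_⟩
  have h1 : WConn (↑(R ∪ σ) : Set (Pt d)) a b :=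
    WConn.mono (by exact_mod_cast hSY) (hS a (by simpa using haS) b (by simpa using hb))
  exact (mem_rootComp.1 ha).2.trans h1

/-- If `Y(σ)` is NOT connected, some cube of `σ` lies outside the root component («If there are other
components …», [II] p. 4). [folklore] -/
theorem exists_not_mem_rootComp {R : Finset (Pt d)} {a₀ : Pt d} (hR : WallConnected (↑R : Set (Pt d)))
    (ha₀ : a₀ ∈ R) {σ : Finset (Pt d)} (h : ¬ WallConnected (↑(R ∪ σ) : Set (Pt d))) :
    ∃ Δ ∈ σ, Δ ∉ rootComp R σ a₀ := by
  by_contra hne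
  exact h ((wallConnected_union_iff hR ha₀ σ).2 fun Δ hΔ => not_not.1 fun hΔ' => hne ⟨Δ, hΔ, hΔ'⟩)

open Classical in
/-- **RESUMMATION OVER CONNECTED DOMAINS** ([folklore] finite-sum bookkeeping): if the `σ`-term vanishes whenever
`Y(σ) = R ∪ σ` is not connected, the sum over all `σ ⊆ σ₀` of (1.9) equals the sum over the connected domains
`Y₀ = R ∪ σ ⊇ □̃⁴` of (1.10). [cite: Balaban1988RG2Cluster, (1.9)–(1.10) p.4] -/
theorem sum_powerset_eq_sum_connected {M : Type*} [AddCommMonoid M] (R σ₀ : Finset (Pt d))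
    (term : Finset (Pt d) → M)
    (hvanish : ∀ σ, σ ⊆ σ₀ → ¬ WallConnected (↑(R ∪ σ) : Set (Pt d)) → term σ = 0) :
    ∑ σ ∈ σ₀.powerset, term σ = ∑ σ ∈ σ₀.powerset with WallConnected (↑(R ∪ σ) : Set (Pt d)), term σ := by
  rw [Finset.sum_filter_of_ne]
  intro σ hσ hne
  by_contra hc
  exact hne (hvanish σ (Finset.mem_powerset.1 hσ) hc)

end Geometry

/-! ## §3 The END: (1.9) = (1.10) for the terms in the Cauchy representation (1.23) -/

section End110

open Literature.MathematicalPhysics.QuantumFieldTheory.Balaban1983to89.B14DomainGeom (Pt)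
open Literature.MathematicalPhysics.QuantumFieldTheory.Balaban1983to89.B13Factor210 (WallConnected)

variable {d : ℕ} {E : Type*}

/-- The parameter vectors of the `σ`-term: complex parameters vanishing off `σ` (the real vector is unconstrained —
it enters only through the Cauchy kernels). [folklore] -/
def ZeroOff (σ : Finset (Pt d)) : (Pt d → ℝ) → (Pt d → ℂ) → Prop := fun _ τ => ∀ Δ, Δ ∉ σ → τ Δ = 0

/-- `ZeroOff σ` is closed under the moves of the iterated operation over the cubes of `σ`. [folklore] -/
theorem movesClosed_zeroOff (σ : Finset (Pt d)) : MovesClosed (ZeroOff σ) σ.toList := by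
  intro s τ hτ i hi u z Δ hΔ
  have hiσ : i ∈ σ := Finset.mem_toList.1 hi
  have hne : Δ ≠ i := fun h => hΔ (h ▸ hiσ)
  simp only [Function.update_of_ne hne]
  exact hτ Δ hΔ

/-- THE SUPPORT HYPOTHESIS of [II] p. 4 for an integrand `F` (the conclusion of the support calculus of the sibling
module `DecouplingSupport110`): for every `σ ⊆ σ₀` and every cube `Δ′ ∈ σ` OUTSIDE the root component `Y₀(σ)`, the
value of `F` at parameters vanishing off `σ` does not depend on the parameter of `Δ′` — *"the term in the sum on the
right-hand side of (1.9), corresponding to the set σ, depends on propagators and function B, s restricted to the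
component Y₀"*. [cite: Balaban1988RG2Cluster, p.4 before (1.10)] -/
def SupportedOnRootComp (F : (Pt d → ℂ) → E) (R σ₀ : Finset (Pt d)) (a₀ : Pt d) : Prop :=
  ∀ σ, σ ⊆ σ₀ → ∀ Δ' ∈ σ, Δ' ∉ rootComp R σ a₀ →
    ∀ τ : Pt d → ℂ, (∀ Δ, Δ ∉ σ → τ Δ = 0) → ∀ z : ℂ, F (Function.update τ Δ' z) = F τ

variable [NormedAddCommGroup E] [NormedSpace ℂ E]

/-- The `σ`-TERM of (1.9) in the representation (1.23): the iterated operation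
`∏_{Δ∈σ} ∫₀¹ds(Δ) (2πi)⁻¹∮_{|σ(Δ)|=ρ} dσ(Δ)∕(σ(Δ) − s(Δ))²` (tree `B13Sect1Arith.cauchyOp`, over the list `σ.toList`)
applied to the integrand `F` — a function of the complexified decoupling parameters — with every unlisted parameter
equal to `0` («with parameters s = 0 on Y₀ᶜ», [II] p. 4; «|_{s(σᶜ) = 0}» in (1.9)).
[cite: Balaban1988RG2Cluster, (1.9) p.4 and (1.23) p.7] -/
def term19 (ρ : ℝ) (F : (Pt d → ℂ) → E) (σ : Finset (Pt d)) : E :=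
  cauchyOp ρ σ.toList (fun _ τ => F τ) 0 0

/-- The term of the EMPTY family (the domain `Y₀ = □̃⁴` itself, no decoupled cube): the integrand at all parameters
`0`. [folklore] -/
theorem term19_empty (ρ : ℝ) (F : (Pt d → ℂ) → E) : term19 ρ F ∅ = F 0 := by
  simp [term19, cauchyOp]

/-- A `σ`-term of (1.9) whose domain `Y(σ)` is not connected VANISHES (given the support hypothesis): [II] p. 4,
*"If there are other components, then the derivatives with respect to s restricted to these components render the
term equal to 0."* [cite: Balaban1988RG2Cluster, p.4 before (1.10)] -/
theorem term19_eq_zero_of_not_wallConnected [CompleteSpace E] (ρ : ℝ) {F : (Pt d → ℂ) → E}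
    {R σ₀ : Finset (Pt d)} {a₀ : Pt d} (hR : WallConnected (↑R : Set (Pt d))) (ha₀ : a₀ ∈ R)
    (hF : SupportedOnRootComp F R σ₀ a₀) {σ : Finset (Pt d)} (hσ : σ ⊆ σ₀)
    (hnc : ¬ WallConnected (↑(R ∪ σ) : Set (Pt d))) : term19 ρ F σ = 0 := by
  obtain ⟨Δ', hΔ'σ, hΔ'⟩ := exists_not_mem_rootComp hR ha₀ hnc
  have hidle : IdleOn (ZeroOff σ) Δ' (fun (_ : Pt d → ℝ) (τ : Pt d → ℂ) => F τ) :=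
    fun _ τ hτ z => hF σ hσ Δ' hΔ'σ hΔ' τ hτ z
  exact cauchyOp_eq_zero_of_idleOn ρ σ.toList (movesClosed_zeroOff σ) (Finset.mem_toList.2 hΔ'σ) hidle 0 0
    (fun _ _ => rfl)

open Classical in
/-- **(1.9) = (1.10)** ([II] p. 4, KERNEL FORM in the representation (1.23)): under the support hypothesis, the
sum of the `σ`-terms over ALL sub-families `σ ⊆ σ₀` equals the sum over those `σ` for which `Y₀ = □̃⁴ ∪ ⋃σ` is a
CONNECTED domain containing `□̃⁴` — *"We can write it as a sum over connected domains Y₀ containing □̃⁴, with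
parameters s = 0 on Y₀ᶜ."* [cite: Balaban1988RG2Cluster, (1.10) p.4] -/
theorem sum_term19_eq_sum_connected [CompleteSpace E] (ρ : ℝ) {F : (Pt d → ℂ) → E}
    {R σ₀ : Finset (Pt d)} {a₀ : Pt d} (hR : WallConnected (↑R : Set (Pt d))) (ha₀ : a₀ ∈ R)
    (hF : SupportedOnRootComp F R σ₀ a₀) :
    ∑ σ ∈ σ₀.powerset, term19 ρ F σ
      = ∑ σ ∈ σ₀.powerset with WallConnected (↑(R ∪ σ) : Set (Pt d)), term19 ρ F σ :=
  sum_powerset_eq_sum_connected R σ₀ (term19 ρ F)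
    fun _ hσ hnc => term19_eq_zero_of_not_wallConnected ρ hR ha₀ hF hσ hnc

end End110

end

end Summit.QuantumFields.BalabanUV.Beta.DecouplingResummation110
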